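import Summits.BirchSwinnertonDyer.BirchSwinnertonDyer.Theorems.ManinLocalTwoThreeShimuraKernelCyclicLattice
import Summits.BirchSwinnertonDyer.BirchSwinnertonDyer.Theorems.ManinLocalTwoThreeShimuraKernelOddPart
import Summits.BirchSwinnertonDyer.BirchSwinnertonDyer.Theorems.ManinLocalTwoThreeKummerValuesHalfIndex
import HarnessLib

/-!
# The Shimura kernel `Λ₀(f)/Λ₁(f)` is CYCLIC — assembly of the `2`-part (p3, Kummer values), the odd part (E-es-189) and the lattice algebra (E-es-190)
(route `ManinLocalTwoThree`, crux C2 `ManinOddAtFour` stmt-BirchSwinnertonDyer-22967; cell bsd-f2-manin, prover seat p2 gen 23;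
`--supports stmt-BirchSwinnertonDyer-22967`; es g40 MEMO §61 composition `shimuraKernelCyclic_of_rows : EXO → 188 → 189 → 190 → desc-2`,
here with 188/189/190 DISCHARGED to their inputs)

For a lattice-optimal `X₀(N)`-datum `D₀` of a globally minimal `W₀` with newform `f`:
* the `2`-part «`Λ₁(f) ⊄ 2Λ₀(f)`» is p3's `KummerValues.not_halfIndex_of_modularity_of_kummerValues` ⟸ modularity ∧ (THEOREM K's Kummer
  values in the half-index world — es's KDR½, e.g. ⟸ T-es-75h, NOT supplied here: it enters as the explicit binder `hKumHalf`);
* the odd part «`Λ₁(f) ⊄ ℓΛ₀(f)`, `ℓ` odd» is `ShimuraKernelOddPart.not_prime_le_of_latticeOptimal` ⟸ F★ ∧ mazur_torsion ∧ CES;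
* the lattice algebra `ShimuraKernelLattice.shimuraKernelCyclic_body_of_parts` turns the two parts into `Λ₀(f) = ℤz₀ + Λ₁(f)`.

* §1 **`shimuraKernelCyclic_body_of_kummerValues`** — per datum: `exists_isNewformOf → F★ → (∀ V, mazur_torsion V) → CES → (lattice-optimal D₀
  of glob.-min. W₀) → (half-index ⟹ Kummer values) → Λ₀(f)/Λ₁(f) cyclic`;
* §2 **`shimuraKernelCyclic_of_facts`** — desc g26 row 2 `ShimuraCyclic.ShimuraKernelCyclic` BY NAME ⟸ the same facts ∧ the half-index
  Kummer-values LAW (explicit binder, es KDR½'s conclusion verbatim) ∧ EXO (es `ExistsMinimalOptimalDatum`, explicit binder: every datum's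
  newform has a lattice-optimal datum on a globally minimal curve); `gamma1PeriodsNotInsideTwice_of_facts` — row 1 BY NAME ⟸ modularity ∧
  the LAW ∧ EXO only; `shimuraIndexNeFourAtFour_of_facts` — E-an-152b BY NAME (desc's glue).

HONEST FRAMING: CONDITIONAL theorems; the binders `hKumHalf` / `hKDR` (Galois input on the `X₁(N)`-cusps, es T-es-75h or SC ∧ T-es-75 ∧ CES)
and `hEXO` are NOT discharged in the tree; F★, CES, `mazur_torsion`, `exists_isNewformOf` are statement-only printed facts.  Print controls the
odd part (Vatsal 2005 p. 15, «étale over ℤ[1/2]»); the `2`-part at every level is the cell's candidate beyond print (es E-es-188).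
Nothing about C2, Manin's conjecture or BSD is proved.  No definitions, no sorry.
[cite: Vatsal2005, Rem. 1.4, Rem. 1.8, Conj. 1.9] [cite: Stevens1989, §2] [cite: Mazur1977, Thm 8] [cite: Hungerford1974, Ch. IV Thm. 6.1]
-/

set_option autoImplicit false
-- lint-debt: the directory name repeats the summit name (sibling precedent `ManinLocalTwoThreeKummerValuesHalfIndex.lean`)
set_option linter.dupNamespace false

noncomputable section

open scoped MatrixGroups
open CongruenceSubgroup WeierstrassCurve Literature.NumberTheory.EllipticCurves Literature.NumberTheory.EllipticCurves.ModularForms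
open Summit.BirchSwinnertonDyer.Rank1Residual.ManinAdditive

namespace Summit.BirchSwinnertonDyer.BirchSwinnertonDyer.Theorems.ManinLocalTwoThree.ShimuraKernelCyclicOfFacts

/-! ## §1 Per datum -/

/-- **The Shimura kernel of a lattice-optimal datum of a globally minimal curve is cyclic, modulo {modularity, F★, Mazur's torsion theorem, CES}
and the Kummer values in the half-index world.**  `Λ₀(f) = ℤz₀ + Λ₁(f)` (verbatim the body of desc's `ShimuraKernelCyclic` at `D₀`).
`2`-part: p3 `KummerValues.not_halfIndex_of_modularity_of_kummerValues`; odd part: `ShimuraKernelOddPart.not_prime_le_of_latticeOptimal`;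
glue: `ShimuraKernelLattice.shimuraKernelCyclic_body_of_parts`.  CONDITIONAL. [cite: Vatsal2005, Rem. 1.8, Conj. 1.9] [cite: Mazur1977, Thm 8] -/
theorem shimuraKernelCyclic_body_of_kummerValues (hnf : exists_isNewformOf) (hF : optimalGamma1Parametrization_cusp_rational)
    (hMT : ∀ V : WeierstrassCurve ℚ, mazur_torsion V) (hCES : exists_optimal_gamma1ParametrizationData)
    (W₀ : WeierstrassCurve ℚ) [W₀.IsElliptic] [W₀.IsGloballyMinimal] {N : ℕ} [NeZero N] (D₀ : ModularParametrizationData W₀ N)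
    (hopt : ∀ z ∈ D₀.L.lattice, ∃ w ∈ periodLattice D₀.f, z = D₀.c * w)
    (hKumHalf : (∀ z ∈ periodLatticeGamma1 D₀.f, ∃ w ∈ periodLattice D₀.f, z = 2 * w) →
      ∀ (σ : ℂ ≃ₐ[ℚ] ℂ) (d d' : ℤ), ((d * d' : ℤ) : ZMod N) = 1 →
      σ (Complex.exp (2 * Real.pi * Complex.I / N)) = Complex.exp (2 * Real.pi * Complex.I * d / N) →
      ∀ (Q y : ℕ), Q * y = N → Nat.Coprime Q y → ∀ γ : Gamma0 N,
        (((γ : SL(2, ℤ)) 1 1 : ℤ) : ZMod Q) = (d' : ZMod Q) → (((γ : SL(2, ℤ)) 1 1 : ℤ) : ZMod y) = 1 →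
        Affine.Point.map (W' := W₀) (σ : ℂ →ₐ[ℚ] ℂ) (D₀.uniformize ((D₀.c : ℂ) * modularSymbol D₀.f (1 / (y : ℚ)) / 2)) =
          D₀.uniformize ((D₀.c : ℂ) * modularSymbol D₀.f (1 / (y : ℚ)) / 2) +
            D₀.uniformize ((D₀.c : ℂ) * cuspSymbol D₀.f γ / 2)) :
    ∃ z₀ ∈ periodLattice D₀.f, ∀ z ∈ periodLattice D₀.f,
      ∃ (k : ℤ) (w : ℂ), w ∈ periodLatticeGamma1 D₀.f ∧ z = (k : ℂ) * z₀ + w :=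
  ShimuraKernelLattice.shimuraKernelCyclic_body_of_parts D₀
    (fun hhalf ↦ KummerValues.not_halfIndex_of_modularity_of_kummerValues hnf W₀ D₀ hopt hhalf (hKumHalf hhalf))
    (fun _ hℓ hℓ2 ↦ ShimuraKernelOddPart.not_prime_le_of_latticeOptimal hF hMT hCES W₀ D₀ hopt hℓ hℓ2)

/-! ## §2 BY NAME, modulo the half-index Kummer-values LAW and the existence row EXO -/

/-- **desc g26 row 1 `Gamma1PeriodsNotInsideTwiceGamma0Periods` BY NAME, CONDITIONAL on modularity, the half-index Kummer-values LAW
(`hKDR`: es KDR½'s conclusion for every lattice-optimal datum of a globally minimal curve in the half-index world — e.g. ⟸ es T-es-75h) and EXO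
(`hEXO`: es `ExistsMinimalOptimalDatum`).**  Per datum this is p3's `not_halfIndex_of_modularity_of_kummerValues`; EXO moves it to every datum
(the row depends on the datum only through its newform). [cite: Stevens1989, §2] [cite: Vatsal2005, Conj. 1.9] -/
theorem gamma1PeriodsNotInsideTwice_of_facts (hnf : exists_isNewformOf)
    (hKDR : ∀ (W₀ : WeierstrassCurve ℚ) [W₀.IsElliptic] [W₀.IsGloballyMinimal] {N : ℕ} [NeZero N]
      (D₀ : ModularParametrizationData W₀ N), (∀ z ∈ D₀.L.lattice, ∃ w ∈ periodLattice D₀.f, z = D₀.c * w) →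
      (∀ z ∈ periodLatticeGamma1 D₀.f, ∃ w ∈ periodLattice D₀.f, z = 2 * w) →
      ∀ (σ : ℂ ≃ₐ[ℚ] ℂ) (d d' : ℤ), ((d * d' : ℤ) : ZMod N) = 1 →
      σ (Complex.exp (2 * Real.pi * Complex.I / N)) = Complex.exp (2 * Real.pi * Complex.I * d / N) →
      ∀ (Q y : ℕ), Q * y = N → Nat.Coprime Q y → ∀ γ : Gamma0 N,
        (((γ : SL(2, ℤ)) 1 1 : ℤ) : ZMod Q) = (d' : ZMod Q) → (((γ : SL(2, ℤ)) 1 1 : ℤ) : ZMod y) = 1 →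
        Affine.Point.map (W' := W₀) (σ : ℂ →ₐ[ℚ] ℂ) (D₀.uniformize ((D₀.c : ℂ) * modularSymbol D₀.f (1 / (y : ℚ)) / 2)) =
          D₀.uniformize ((D₀.c : ℂ) * modularSymbol D₀.f (1 / (y : ℚ)) / 2) +
            D₀.uniformize ((D₀.c : ℂ) * cuspSymbol D₀.f γ / 2))
    (hEXO : ∀ (W : WeierstrassCurve ℚ) [W.IsElliptic] {N : ℕ} [NeZero N] (D : ModularParametrizationData W N),
      ∃ (W₀ : WeierstrassCurve ℚ) (_ : W₀.IsElliptic) (_ : W₀.IsGloballyMinimal) (D₀ : ModularParametrizationData W₀ N),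
        D₀.f = D.f ∧ ∀ z ∈ D₀.L.lattice, ∃ w ∈ periodLattice D₀.f, z = D₀.c * w) :
    ShimuraCyclic.Gamma1PeriodsNotInsideTwiceGamma0Periods := by
  intro W _ N _ D hhalf
  obtain ⟨W₀, _, _, D₀, hf, hopt⟩ := hEXO W D
  rw [← hf] at hhalf
  exact KummerValues.not_halfIndex_of_modularity_of_kummerValues hnf W₀ D₀ hopt hhalf (hKDR W₀ D₀ hopt hhalf)

/-- **desc g26 row 2 `ShimuraKernelCyclic` BY NAME, CONDITIONAL on {modularity, F★, Mazur's torsion theorem, CES}, the half-index Kummer-values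
LAW `hKDR` and EXO.**  (§1 per lattice-optimal datum of a globally minimal curve; EXO moves it to every datum.)  Honest framing: the LAW and EXO
are not tree facts; print has the odd part only (Vatsal 2005, p. 15). [cite: Vatsal2005, Rem. 1.8, Conj. 1.9] [cite: Mazur1977, Thm 8] -/
theorem shimuraKernelCyclic_of_facts (hnf : exists_isNewformOf) (hF : optimalGamma1Parametrization_cusp_rational)
    (hMT : ∀ V : WeierstrassCurve ℚ, mazur_torsion V) (hCES : exists_optimal_gamma1ParametrizationData)
    (hKDR : ∀ (W₀ : WeierstrassCurve ℚ) [W₀.IsElliptic] [W₀.IsGloballyMinimal] {N : ℕ} [NeZero N]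
      (D₀ : ModularParametrizationData W₀ N), (∀ z ∈ D₀.L.lattice, ∃ w ∈ periodLattice D₀.f, z = D₀.c * w) →
      (∀ z ∈ periodLatticeGamma1 D₀.f, ∃ w ∈ periodLattice D₀.f, z = 2 * w) →
      ∀ (σ : ℂ ≃ₐ[ℚ] ℂ) (d d' : ℤ), ((d * d' : ℤ) : ZMod N) = 1 →
      σ (Complex.exp (2 * Real.pi * Complex.I / N)) = Complex.exp (2 * Real.pi * Complex.I * d / N) →
      ∀ (Q y : ℕ), Q * y = N → Nat.Coprime Q y → ∀ γ : Gamma0 N,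
        (((γ : SL(2, ℤ)) 1 1 : ℤ) : ZMod Q) = (d' : ZMod Q) → (((γ : SL(2, ℤ)) 1 1 : ℤ) : ZMod y) = 1 →
        Affine.Point.map (W' := W₀) (σ : ℂ →ₐ[ℚ] ℂ) (D₀.uniformize ((D₀.c : ℂ) * modularSymbol D₀.f (1 / (y : ℚ)) / 2)) =
          D₀.uniformize ((D₀.c : ℂ) * modularSymbol D₀.f (1 / (y : ℚ)) / 2) +
            D₀.uniformize ((D₀.c : ℂ) * cuspSymbol D₀.f γ / 2))
    (hEXO : ∀ (W : WeierstrassCurve ℚ) [W.IsElliptic] {N : ℕ} [NeZero N] (D : ModularParametrizationData W N),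
      ∃ (W₀ : WeierstrassCurve ℚ) (_ : W₀.IsElliptic) (_ : W₀.IsGloballyMinimal) (D₀ : ModularParametrizationData W₀ N),
        D₀.f = D.f ∧ ∀ z ∈ D₀.L.lattice, ∃ w ∈ periodLattice D₀.f, z = D₀.c * w) :
    ShimuraCyclic.ShimuraKernelCyclic := by
  intro W _ N _ D
  obtain ⟨W₀, _, _, D₀, hf, hopt⟩ := hEXO W D
  rw [← hf]
  exact shimuraKernelCyclic_body_of_kummerValues hnf hF hMT hCES W₀ D₀ hopt (hKDR W₀ D₀ hopt)

/-- **E-an-152b `ShimuraIndexNeFourAtFour` BY NAME from the same inputs as row 1** (desc's glue `shimuraIndexNeFourAtFour_of_notInsideTwice`).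
CONDITIONAL. [cite: Stevens1989, §2] -/
theorem shimuraIndexNeFourAtFour_of_facts (hnf : exists_isNewformOf)
    (hKDR : ∀ (W₀ : WeierstrassCurve ℚ) [W₀.IsElliptic] [W₀.IsGloballyMinimal] {N : ℕ} [NeZero N]
      (D₀ : ModularParametrizationData W₀ N), (∀ z ∈ D₀.L.lattice, ∃ w ∈ periodLattice D₀.f, z = D₀.c * w) →
      (∀ z ∈ periodLatticeGamma1 D₀.f, ∃ w ∈ periodLattice D₀.f, z = 2 * w) →
      ∀ (σ : ℂ ≃ₐ[ℚ] ℂ) (d d' : ℤ), ((d * d' : ℤ) : ZMod N) = 1 →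
      σ (Complex.exp (2 * Real.pi * Complex.I / N)) = Complex.exp (2 * Real.pi * Complex.I * d / N) →
      ∀ (Q y : ℕ), Q * y = N → Nat.Coprime Q y → ∀ γ : Gamma0 N,
        (((γ : SL(2, ℤ)) 1 1 : ℤ) : ZMod Q) = (d' : ZMod Q) → (((γ : SL(2, ℤ)) 1 1 : ℤ) : ZMod y) = 1 →
        Affine.Point.map (W' := W₀) (σ : ℂ →ₐ[ℚ] ℂ) (D₀.uniformize ((D₀.c : ℂ) * modularSymbol D₀.f (1 / (y : ℚ)) / 2)) =
          D₀.uniformize ((D₀.c : ℂ) * modularSymbol D₀.f (1 / (y : ℚ)) / 2) +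
            D₀.uniformize ((D₀.c : ℂ) * cuspSymbol D₀.f γ / 2))
    (hEXO : ∀ (W : WeierstrassCurve ℚ) [W.IsElliptic] {N : ℕ} [NeZero N] (D : ModularParametrizationData W N),
      ∃ (W₀ : WeierstrassCurve ℚ) (_ : W₀.IsElliptic) (_ : W₀.IsGloballyMinimal) (D₀ : ModularParametrizationData W₀ N),
        D₀.f = D.f ∧ ∀ z ∈ D₀.L.lattice, ∃ w ∈ periodLattice D₀.f, z = D₀.c * w) :
    ShimuraKernel.ShimuraIndexNeFourAtFour :=
  ShimuraCyclic.shimuraIndexNeFourAtFour_of_notInsideTwice (gamma1PeriodsNotInsideTwice_of_facts hnf hKDR hEXO)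

/-! ## §3 (appended, p2 gen 23) The cyclicity package modulo {modularity, CES, T-es-75} only

p3 gen 20 (p764298/p764383, `…KummerValuesHalfIndex` §3–§5) made BOTH parts of §1 cheaper: the odd part is FACT-FREE
(`KummerValues.not_periodLatticeGamma1_le_natCast_mul_periodLattice`: complex conjugation is trivial on `Λ₀/Λ₁` and has trace `0` on
`Λ_{E₀}`), and the half-index Kummer values follow from CES ∧ T-es-75 (`KummerValues.halfIndex_kummerValues_of_Tes75_CES`, es's SC being a
tree theorem), packaged as `KummerValues.not_periodLatticeGamma1_le_prime_mul_of_modularity_CES_Tes75` (every prime).  With E-es-190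
(`ShimuraKernelLattice.cyclic_of_forall_prime_not_le_datum`) this gives desc row 2's body on every lattice-optimal member modulo three
printed facts, and the rows BY NAME modulo EXO in addition. -/

/-- **The Shimura kernel `Λ₀(f)/Λ₁(f)` of a lattice-optimal datum of a globally minimal curve is CYCLIC, modulo {modularity, CES, T-es-75}**
(three statement-only printed facts; no F★, no Mazur, no extra Galois law): p3's all-primes exclusion
`KummerValues.not_periodLatticeGamma1_le_prime_mul_of_modularity_CES_Tes75` + E-es-190 `ShimuraKernelLattice.cyclic_of_forall_prime_not_le_datum`.
Verbatim the body of desc's `ShimuraCyclic.ShimuraKernelCyclic` at `D₀`.  CONDITIONAL; nothing about C2 or BSD.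
[cite: Vatsal2005, Rem. 1.8, Conj. 1.9] [cite: Stevens1982, §1.3 Thm. 1.3.1 (b)] [cite: ConradEdixhovenStein2003, Thm. 1.1.3] -/
theorem shimuraKernelCyclic_body_of_modularity_CES_Tes75 (hnf : exists_isNewformOf) (hCES : exists_optimal_gamma1ParametrizationData)
    (hSt : optimalGamma1Parametrization_cuspInv_galoisAction)
    (W₀ : WeierstrassCurve ℚ) [W₀.IsElliptic] [W₀.IsGloballyMinimal] {N : ℕ} [NeZero N] (D₀ : ModularParametrizationData W₀ N)
    (hopt : ∀ z ∈ D₀.L.lattice, ∃ w ∈ periodLattice D₀.f, z = D₀.c * w) :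
    ∃ z₀ ∈ periodLattice D₀.f, ∀ z ∈ periodLattice D₀.f,
      ∃ (k : ℤ) (w : ℂ), w ∈ periodLatticeGamma1 D₀.f ∧ z = (k : ℂ) * z₀ + w :=
  ShimuraKernelLattice.cyclic_of_forall_prime_not_le_datum D₀ fun _ hp ↦
    KummerValues.not_periodLatticeGamma1_le_prime_mul_of_modularity_CES_Tes75 hnf hCES hSt W₀ D₀ hopt hp

/-- **desc g26 row 2 `ShimuraCyclic.ShimuraKernelCyclic` BY NAME modulo {modularity, CES, T-es-75} and EXO** (es `ExistsMinimalOptimalDatum`,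
explicit binder: the row depends on the datum only through its newform, which EXO realises on a lattice-optimal datum of a globally
minimal curve).  CONDITIONAL; EXO is not a tree fact (it is Edixhoven 1991 Prop. 2 by content). [cite: Vatsal2005, Conj. 1.9] [cite: EdixhovenManin1991, Prop. 2] -/
theorem shimuraKernelCyclic_of_modularity_CES_Tes75_EXO (hnf : exists_isNewformOf) (hCES : exists_optimal_gamma1ParametrizationData)
    (hSt : optimalGamma1Parametrization_cuspInv_galoisAction)
    (hEXO : ∀ (W : WeierstrassCurve ℚ) [W.IsElliptic] {N : ℕ} [NeZero N] (D : ModularParametrizationData W N),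
      ∃ (W₀ : WeierstrassCurve ℚ) (_ : W₀.IsElliptic) (_ : W₀.IsGloballyMinimal) (D₀ : ModularParametrizationData W₀ N),
        D₀.f = D.f ∧ ∀ z ∈ D₀.L.lattice, ∃ w ∈ periodLattice D₀.f, z = D₀.c * w) :
    ShimuraCyclic.ShimuraKernelCyclic := by
  intro W _ N _ D
  obtain ⟨W₀, _, _, D₀, hf, hopt⟩ := hEXO W D
  rw [← hf]
  exact shimuraKernelCyclic_body_of_modularity_CES_Tes75 hnf hCES hSt W₀ D₀ hopt

/-- **desc g26 row 1 `Gamma1PeriodsNotInsideTwiceGamma0Periods` BY NAME modulo {modularity, CES, T-es-75} and EXO** (p3's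
`KummerValues.not_halfIndex_of_modularity_CES_Tes75` per lattice-optimal datum; EXO moves it to every datum).  CONDITIONAL.
[cite: Stevens1989, §2] [cite: Vatsal2005, Conj. 1.9] -/
theorem gamma1PeriodsNotInsideTwice_of_modularity_CES_Tes75_EXO (hnf : exists_isNewformOf)
    (hCES : exists_optimal_gamma1ParametrizationData) (hSt : optimalGamma1Parametrization_cuspInv_galoisAction)
    (hEXO : ∀ (W : WeierstrassCurve ℚ) [W.IsElliptic] {N : ℕ} [NeZero N] (D : ModularParametrizationData W N),
      ∃ (W₀ : WeierstrassCurve ℚ) (_ : W₀.IsElliptic) (_ : W₀.IsGloballyMinimal) (D₀ : ModularParametrizationData W₀ N),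
        D₀.f = D.f ∧ ∀ z ∈ D₀.L.lattice, ∃ w ∈ periodLattice D₀.f, z = D₀.c * w) :
    ShimuraCyclic.Gamma1PeriodsNotInsideTwiceGamma0Periods :=
  ShimuraCyclic.notInsideTwice_of_shimuraKernelCyclic (shimuraKernelCyclic_of_modularity_CES_Tes75_EXO hnf hCES hSt hEXO)

/-- **E-an-152b `ShimuraIndexNeFourAtFour` BY NAME modulo {modularity, CES, T-es-75} and EXO** (desc's glue).  CONDITIONAL. [cite: Stevens1989, §2] -/
theorem shimuraIndexNeFourAtFour_of_modularity_CES_Tes75_EXO (hnf : exists_isNewformOf)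
    (hCES : exists_optimal_gamma1ParametrizationData) (hSt : optimalGamma1Parametrization_cuspInv_galoisAction)
    (hEXO : ∀ (W : WeierstrassCurve ℚ) [W.IsElliptic] {N : ℕ} [NeZero N] (D : ModularParametrizationData W N),
      ∃ (W₀ : WeierstrassCurve ℚ) (_ : W₀.IsElliptic) (_ : W₀.IsGloballyMinimal) (D₀ : ModularParametrizationData W₀ N),
        D₀.f = D.f ∧ ∀ z ∈ D₀.L.lattice, ∃ w ∈ periodLattice D₀.f, z = D₀.c * w) :
    ShimuraKernel.ShimuraIndexNeFourAtFour :=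
  ShimuraCyclic.shimuraIndexNeFourAtFour_of_shimuraKernelCyclic (shimuraKernelCyclic_of_modularity_CES_Tes75_EXO hnf hCES hSt hEXO)

end Summit.BirchSwinnertonDyer.BirchSwinnertonDyer.Theorems.ManinLocalTwoThree.ShimuraKernelCyclicOfFacts

end
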